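/-
Copyright: the b2b-balaban cell (near-miss cell 7), T⁴-continuum fan-out; row NE7b ROUND-2 swarm, seat
t4-ne7b-formalise-leaf-05 gen 2 (row S6g′(c) of `t4/b2b-balaban-t4-ne7b-p1/LEAVES-NE7b.md`, owner's ruling R-OWNER-22-12 (2)).
Released under the licence of the surrounding project.
-/
import Mathlib

/-!
# Sibling symmetry, part 1: the FOREST HULL of a join and its count (row S6g′(c), join-level combinatorics)

Summits-side support leaf of the T⁴-continuum cell (rung (B)+1 on a FINITE torus only; NOT infinite volume, NOT the
mass gap, NOT the Clay statement; NOT a proof of the spine estimate NE7b).  Row NE7b, route «COUNT»; the owner's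
re-specified row S6g′ «MASS-BASED SIBLING COUNT» (R-OWNER-22-12 (2)), its step (c) «per-(step, shape)
symmetrisation».  [folklore] finite combinatorics over ABSTRACT finite types (a part type `I`, a position type `Pos`);
nothing is quoted from print, nothing printed is asserted, no `[cite:]` tag, no `Prop` fact of Bałaban's is minted;
no `Gen`, no torus — those are rows S6g′(a) (leaf-01, the cardinality law of the zone reading) and S6g′(b) (leaf-10
gen 2, `HistoryMassPlacement`: the one-block touch counts), which this file's binders `M`-via-`N` receive BY VALUE.

WHY.  At one step a new component is a JOIN of finitely many PARTS (old pending components and new birth regions)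
around a HOST (the oldest part); the tagged genealogy records the join as a chain of binary mergers in SOME contact
order.  Counting the placements of the parts merger by merger along the chain («part `i` touches the ACCUMULATED set»)
is order-dependent: the chain-admissible set is NOT invariant under permuting equal-shape parts (part 2 touching the
host and part 3 touching only part 2, swapped, is not chain-admissible), so the symmetry credit `∏_g k_g!` of
`HistorySiblingMass.total_cost_le` cannot be taken over it by a free-action argument — and «chain count ∕ ∏ k_g!» is not
even an inequality (unit host, `k` equal porous parts of zone mass `m` in a path: physical configurations
`≍ c^k m^{2k−1}`, chain product ∕ `k!` `≍ c^k m^{2k−1}∕k`).  The cure is to count the permutation-invariant HULL: a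
configuration of the parts is FOREST-ADMISSIBLE iff the parts' touch graph contains a spanning tree rooted at the host
(iff it is connected).  Every contact order is such a tree (`forestAdm_of_chain`), so nothing breadth-first is asked of
the encoding; and the hull is counted WITHOUT Cayley's tree formula: place the parts along the tree by increasing rank
(one slot factor `N i (par i)` per non-host part), then sum the parent of EVERY part over ALL parts —
`Σ_par ∏_i N i (par i) ≤ ∏_i Σ_j N i j` (`Finset.sum_prod_piFinset`).  With `N i j = c_d·M j·(M i·Λ^{a i}·W i)`
(host side: the CARDINALITY `M j` of the touched part's zone = row S6g′(a); partner side: row S6g′(b)'s one-block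
touch count times the part's internal placements) this is `(c_d·S)^{r−1}·∏_{i ≠ h} M i·Λ^{a i}·W i`, `S = Σ_parts M`
(`S ≤ C·Q_t`: the parts of the joins of one step are disjoint sub-structures) — per join exactly the summand
`k·log Q − log k!` of `HistorySiblingMass.step_cost_le` once the orbit count of part 2 divides by `∏_g k_g!`, plus the
non-host parts' own (decayed) masses and the ages (into `partnerAges`).

WHAT.  §1 `Acyclic`, **`ForestAdm ok touch h c`**, `ForestAdm.mono`, **`forestAdm_of_chain`** (any contact order is a
rooted forest).  §2 `forestSet` (host pinned at `p₀`) and **`card_forestSet_le : #forestSet ≤ ∏_{i ≠ h} Σ_j N i j`** from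
the one-edge slot bound `#{p | ok i p ∧ touch i p j q} ≤ N i j` (levels `levSet`, reset map, fibres `≤ ∏_{rank = n} N`,
`card_treeSet_le`, union over acyclic parent maps).  §3 **`forestAdm_comp_perm`** ∕ `mem_forestSet_comp_perm`:
invariance under a permutation of the parts fixing the host along which `ok`∕`touch` are invariant (parts read through
their tagged SHAPE only) — the input of part 2's free-orbit count.  §4 the product form for `N i j ≤ A i * B j`.

HONEST SCOPE.  Join-level skeleton only: `M`, `Λ^{a}`, `W`, `c_d` enter by value through `N`; the instantiation on
tagged genealogies (parts = maximal sub-structures below a same-step merger cluster; `touch` = the thickened zones share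
a block; `ok` = internal admissibility) binds rows (a)(b) and is NOT here.  The extra factor `S∕M_host ≤ S` per join
(against Cayley's exact `S^{r−2}·M_host`) is one more «merger» in `step_cost_le`'s count `n_t`.  NE7b NOT proved.

HONEST DEPENDENCY (cell): continuum YM on T⁴ ⇐ BetaPertH ∧ nine spine estimates (0/9 proved); BetaPertH ⇐ (D1) ∧ (D4)
∧ CAP+tail.  This file changes none of it.
-/

open Finset

namespace Summit.QuantumFields.BalabanUV.T4Continuum.HistorySiblingSymmetry

noncomputable section

/-! ## §1 Forest admissibility of a join configuration -/

section Defs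

variable {I Pos : Type*}

/-- `Acyclic h par`: some rank function strictly decreases along the parent map on the non-host parts (so iterating
`par` from any part reaches the host `h`: a forest rooted at `h`). [folklore] -/
def Acyclic (h : I) (par : I → I) : Prop :=
  ∃ rk : I → ℕ, ∀ i, i ≠ h → rk (par i) < rk i

/-- **FOREST ADMISSIBILITY** of a configuration `c : I → Pos` of the parts of one join with host `h`: every non-host part
is internally admissible (`ok i (c i)`) and TOUCHES ITS PARENT (`touch i (c i) (par i) (c (par i))`) for some acyclic
parent map — the parts' touch graph contains a spanning tree rooted at the host. [folklore] -/
def ForestAdm (ok : I → Pos → Prop) (touch : I → Pos → I → Pos → Prop) (h : I) (c : I → Pos) : Prop :=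
  ∃ par : I → I, Acyclic h par ∧ ∀ i, i ≠ h → ok i (c i) ∧ touch i (c i) (par i) (c (par i))

/-- monotonicity in the two predicates [folklore] -/
theorem ForestAdm.mono {ok ok' : I → Pos → Prop} {touch touch' : I → Pos → I → Pos → Prop} {h : I} {c : I → Pos}
    (hok : ∀ i p, ok i p → ok' i p) (ht : ∀ i p j q, touch i p j q → touch' i p j q)
    (hc : ForestAdm ok touch h c) : ForestAdm ok' touch' h c := by
  obtain ⟨par, hac, hpar⟩ := hc
  exact ⟨par, hac, fun i hi => ⟨hok _ _ (hpar i hi).1, ht _ _ _ _ (hpar i hi).2⟩⟩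

/-- **EVERY CONTACT ORDER IS A ROOTED FOREST.**  If the parts carry an index `idx : I → ℕ` (a contact order, host
anywhere) such that every non-host part is internally admissible and touches SOME part of strictly smaller index,
then the configuration is forest-admissible (parent := that part, rank := the index). [folklore] -/
theorem forestAdm_of_chain (ok : I → Pos → Prop) (touch : I → Pos → I → Pos → Prop) (h : I) (c : I → Pos) (idx : I → ℕ)
    (hc : ∀ i, i ≠ h → ok i (c i) ∧ ∃ j, idx j < idx i ∧ touch i (c i) j (c j)) : ForestAdm ok touch h c := by
  classical
  haveI : Nonempty I := ⟨h⟩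
  have hex : ∀ i, i ≠ h → ∃ j, idx j < idx i ∧ touch i (c i) j (c j) := fun i hi => (hc i hi).2
  choose! par hlt htouch using hex
  exact ⟨par, ⟨idx, fun i hi => hlt i hi⟩, fun i hi => ⟨(hc i hi).1, htouch i hi⟩⟩

/-- a STAR (every other part touches the host) is forest-admissible [folklore] -/
theorem forestAdm_of_star (ok : I → Pos → Prop) (touch : I → Pos → I → Pos → Prop) (h : I) (c : I → Pos)
    (hc : ∀ i, i ≠ h → ok i (c i) ∧ touch i (c i) h (c h)) : ForestAdm ok touch h c := by
  classical
  refine ⟨fun _ => h, ⟨fun i => if i = h then 0 else 1, fun i hi => ?_⟩, fun i hi => hc i hi⟩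
  simp [hi]

end Defs

/-! ## §2 The count of the forest hull -/

section Count

variable {I Pos : Type*} [Fintype I] [DecidableEq I] [Fintype Pos] [DecidableEq Pos]

open scoped Classical

/-- The forest-admissible configurations with the host pinned at `p₀`. [folklore] -/
def forestSet (ok : I → Pos → Prop) (touch : I → Pos → I → Pos → Prop) (h : I) (p₀ : Pos) : Finset (I → Pos) :=
  univ.filter fun c => c h = p₀ ∧ ForestAdm ok touch h c

/-- membership [folklore] -/
theorem mem_forestSet {ok : I → Pos → Prop} {touch : I → Pos → I → Pos → Prop} {h : I} {p₀ : Pos} {c : I → Pos} :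
    c ∈ forestSet ok touch h p₀ ↔ c h = p₀ ∧ ForestAdm ok touch h c := by
  simp [forestSet]

variable (ok : I → Pos → Prop) (touch : I → Pos → I → Pos → Prop) (h : I) (p₀ : Pos)

/-- configurations touching along a FIXED parent map `f` on the non-host parts, host pinned [folklore] -/
def treeSet (f : {i // i ≠ h} → I) : Finset (I → Pos) :=
  univ.filter fun c => c h = p₀ ∧ ∀ i : {i // i ≠ h}, ok i.1 (c i.1) ∧ touch i.1 (c i.1) (f i) (c (f i))

/-- LEVEL `n` along a rank `rk`: the parts of rank `< n` placed and touching their parents, the parts of rank `≥ n`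
parked at `p₀`. [folklore] -/
def levSet (f : {i // i ≠ h} → I) (rk : I → ℕ) (n : ℕ) : Finset (I → Pos) :=
  univ.filter fun c => c h = p₀ ∧
    (∀ i : {i // i ≠ h}, rk i.1 < n → ok i.1 (c i.1) ∧ touch i.1 (c i.1) (f i) (c (f i))) ∧
    (∀ i : {i // i ≠ h}, n ≤ rk i.1 → c i.1 = p₀)

/-- the reset map: park the parts of rank `n` back at `p₀` [folklore] -/
def reset (rk : I → ℕ) (n : ℕ) (c : I → Pos) : I → Pos :=
  fun i => if i ≠ h ∧ rk i = n then p₀ else c i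

variable {ok touch h p₀}

omit [Fintype I] [Fintype Pos] [DecidableEq Pos] in
/-- the reset map does not move the host [folklore] -/
theorem reset_host (rk : I → ℕ) (n : ℕ) (c : I → Pos) : reset h p₀ rk n c h = c h := by
  simp [reset]

omit [Fintype I] [Fintype Pos] [DecidableEq Pos] in
/-- the reset map does not move parts of other ranks [folklore] -/
theorem reset_of_ne {rk : I → ℕ} {n : ℕ} (c : I → Pos) {i : I} (hi : rk i ≠ n) : reset h p₀ rk n c i = c i := by
  simp [reset, hi]

/-- level `0` holds at most the parked configuration [folklore] -/
theorem card_levSet_zero (f : {i // i ≠ h} → I) (rk : I → ℕ) : (levSet ok touch h p₀ f rk 0).card ≤ 1 := by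
  refine Finset.card_le_one.2 fun c hc c' hc' => ?_
  simp only [levSet, mem_filter, mem_univ, true_and] at hc hc'
  funext i
  by_cases hi : i = h
  · rw [hi, hc.1, hc'.1]
  · rw [hc.2.2 ⟨i, hi⟩ (Nat.zero_le _), hc'.2.2 ⟨i, hi⟩ (Nat.zero_le _)]

/-- **ONE LEVEL UP COSTS THE SLOTS OF THAT RANK.**  Along an acyclic parent map, resetting the parts of rank `n` maps
level `n+1` into level `n`, and each fibre injects into the product of the slot sets of the rank-`n` parts next to
their (already placed) parents. [folklore] -/
theorem card_levSet_succ_le (N : I → I → ℕ)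
    (hN : ∀ i, i ≠ h → ∀ j q, (univ.filter fun p : Pos => ok i p ∧ touch i p j q).card ≤ N i j)
    (f : {i // i ≠ h} → I) (rk : I → ℕ) (hrk : ∀ i : {i // i ≠ h}, rk (f i) < rk i.1) (n : ℕ) :
    (levSet ok touch h p₀ f rk (n + 1)).card ≤
      (∏ i ∈ (univ : Finset {i // i ≠ h}).filter (fun i => rk i.1 = n), N i.1 (f i)) *
        (levSet ok touch h p₀ f rk n).card := by
  -- the reset map lands in level `n`
  have hmaps : ∀ c ∈ levSet ok touch h p₀ f rk (n + 1), reset h p₀ rk n c ∈ levSet ok touch h p₀ f rk n := by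
    intro c hc
    simp only [levSet, mem_filter, mem_univ, true_and] at hc ⊢
    obtain ⟨hh, hlt, hge⟩ := hc
    refine ⟨by rw [reset_host, hh], fun i hi => ?_, fun i hi => ?_⟩
    · have hi' : rk i.1 ≠ n := Nat.ne_of_lt hi
      have hf' : rk (f i) ≠ n := Nat.ne_of_lt ((hrk i).trans hi)
      rw [reset_of_ne c hi', reset_of_ne c hf']
      exact hlt i (Nat.lt_succ_of_lt hi)
    · by_cases he : rk i.1 = n
      · simp [reset, i.2, he]
      · rw [reset_of_ne c he]
        exact hge i (by omega)
  -- each fibre injects into the product of the slot sets of the rank-`n` parts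
  have hfib : ∀ c₀ ∈ levSet ok touch h p₀ f rk n,
      ((levSet ok touch h p₀ f rk (n + 1)).filter fun c => reset h p₀ rk n c = c₀).card ≤
        ∏ i ∈ (univ : Finset {i // i ≠ h}).filter (fun i => rk i.1 = n), N i.1 (f i) := by
    intro c₀ _
    -- the slot sets, indexed by the rank-`n` parts
    let L := {i : {i // i ≠ h} // rk i.1 = n}
    let t : L → Finset Pos := fun a => univ.filter fun p : Pos => ok a.1 p ∧ touch a.1 p (f a.1) (c₀ (f a.1))
    have hcard : (Fintype.piFinset t).card ≤
        ∏ i ∈ (univ : Finset {i // i ≠ h}).filter (fun i => rk i.1 = n), N i.1 (f i) := by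
      rw [Fintype.card_piFinset]
      rw [prod_subtype ((univ : Finset {i // i ≠ h}).filter fun i => rk i.1 = n) (p := fun i : {i // i ≠ h} => rk i.1 = n)
        (fun i => by simp)]
      exact prod_le_prod (fun _ _ => Nat.zero_le _) fun a _ => hN a.1.1 a.1.2 _ _
    refine le_trans (card_le_card_of_injOn (fun c => fun a : L => c a.1.1) (fun c hc => ?_) ?_) hcard
    · -- maps into the product
      replace hc := Finset.mem_coe.1 hc
      rw [mem_filter] at hc
      obtain ⟨hc, hres⟩ := hc
      simp only [levSet, mem_filter, mem_univ, true_and] at hc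
      obtain ⟨-, hlt, -⟩ := hc
      refine Finset.mem_coe.2 (Fintype.mem_piFinset.2 fun a => ?_)
      have ha : rk a.1.1 < n + 1 := by have := a.2; omega
      have hfa : rk (f a.1) ≠ n := by have h1 := hrk a.1; have h2 := a.2; omega
      have hcf : c (f a.1) = c₀ (f a.1) := by rw [← hres, reset_of_ne c hfa]
      simp only [t, mem_filter, mem_univ, true_and]
      rw [← hcf]
      exact hlt a.1 ha
    · -- injective: off the rank-`n` parts both configurations agree with `c₀`
      intro c hc c' hc' heq
      replace hc := Finset.mem_coe.1 hc
      replace hc' := Finset.mem_coe.1 hc'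
      rw [mem_filter] at hc hc'
      funext i
      by_cases hi : i ≠ h ∧ rk i = n
      · exact congrFun heq ⟨⟨i, hi.1⟩, hi.2⟩
      · have h1 : reset h p₀ rk n c i = c i := by simp [reset, hi]
        have h2 : reset h p₀ rk n c' i = c' i := by simp [reset, hi]
        rw [← h1, ← h2, hc.2, hc'.2]
  exact card_le_mul_card_image_of_maps_to hmaps _ hfib

omit [Fintype Pos] [DecidableEq Pos] in
/-- splitting the rank filter: `rank < n+1` = `rank < n` ⊔ `rank = n` [folklore] -/
theorem prod_filter_rank_lt_succ (N : I → I → ℕ) (f : {i // i ≠ h} → I) (rk : I → ℕ) (n : ℕ) :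
    ∏ i ∈ (univ : Finset {i // i ≠ h}).filter (fun i => rk i.1 < n + 1), N i.1 (f i) =
      (∏ i ∈ (univ : Finset {i // i ≠ h}).filter (fun i => rk i.1 = n), N i.1 (f i)) *
        ∏ i ∈ (univ : Finset {i // i ≠ h}).filter (fun i => rk i.1 < n), N i.1 (f i) := by
  have hsplit : (univ : Finset {i // i ≠ h}).filter (fun i => rk i.1 < n + 1) =
      (univ : Finset {i // i ≠ h}).filter (fun i => rk i.1 = n) ∪
        (univ : Finset {i // i ≠ h}).filter (fun i => rk i.1 < n) := by
    ext i; simp only [mem_filter, mem_univ, true_and, mem_union]; omega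
  have hdisj : Disjoint ((univ : Finset {i // i ≠ h}).filter (fun i => rk i.1 = n))
      ((univ : Finset {i // i ≠ h}).filter (fun i => rk i.1 < n)) := by
    rw [disjoint_filter]; intro i _ h1; omega
  rw [hsplit, prod_union hdisj]

/-- **LEVEL `n` COSTS THE SLOTS OF THE RANKS BELOW `n`** (induction on `n`). [folklore] -/
theorem card_levSet_le (N : I → I → ℕ)
    (hN : ∀ i, i ≠ h → ∀ j q, (univ.filter fun p : Pos => ok i p ∧ touch i p j q).card ≤ N i j)
    (f : {i // i ≠ h} → I) (rk : I → ℕ) (hrk : ∀ i : {i // i ≠ h}, rk (f i) < rk i.1) :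
    ∀ n : ℕ, (levSet ok touch h p₀ f rk n).card ≤
      ∏ i ∈ (univ : Finset {i // i ≠ h}).filter (fun i => rk i.1 < n), N i.1 (f i)
  | 0 => by
      have : (univ : Finset {i // i ≠ h}).filter (fun i => rk i.1 < 0) = ∅ := by ext i; simp
      rw [this, prod_empty]
      exact card_levSet_zero f rk
  | n + 1 => by
      rw [prod_filter_rank_lt_succ]
      exact (card_levSet_succ_le N hN f rk hrk n).trans (Nat.mul_le_mul_left _ (card_levSet_le N hN f rk hrk n))

/-- **A FIXED ACYCLIC PARENT MAP COSTS ONE SLOT FACTOR PER NON-HOST PART**: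
`#treeSet f ≤ ∏_{i ≠ h} N i.1 (f i)`. [folklore] -/
theorem card_treeSet_le (N : I → I → ℕ)
    (hN : ∀ i, i ≠ h → ∀ j q, (univ.filter fun p : Pos => ok i p ∧ touch i p j q).card ≤ N i j)
    (f : {i // i ≠ h} → I) (rk : I → ℕ) (hrk : ∀ i : {i // i ≠ h}, rk (f i) < rk i.1) :
    (treeSet ok touch h p₀ f).card ≤ ∏ i : {i // i ≠ h}, N i.1 (f i) := by
  set M := (univ : Finset I).sup rk with hM
  -- every admissible configuration is at the top level
  have hsub : treeSet ok touch h p₀ f ⊆ levSet ok touch h p₀ f rk (M + 1) := by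
    intro c hc
    simp only [treeSet, levSet, mem_filter, mem_univ, true_and] at hc ⊢
    refine ⟨hc.1, fun i _ => hc.2 i, fun i hi => ?_⟩
    have : rk i.1 ≤ M := le_sup (f := rk) (mem_univ i.1)
    omega
  have htop : (univ : Finset {i // i ≠ h}).filter (fun i => rk i.1 < M + 1) = univ := by
    ext i
    simp only [mem_filter, mem_univ, true_and, iff_true]
    have : rk i.1 ≤ M := le_sup (f := rk) (mem_univ i.1)
    omega
  have := card_levSet_le (p₀ := p₀) N hN f rk hrk (M + 1)
  rw [htop] at this
  exact (card_le_card hsub).trans this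

/-- **THE COUNT OF THE FOREST HULL.**  From the one-edge slot bound `#{p | ok i p ∧ touch i p j q} ≤ N i j` (every
non-host part `i`, every part `j` at every position `q`): `#forestSet ok touch h p₀ ≤ ∏_{i ≠ h} Σ_j N i j` — union over
the parent maps, one slot factor per non-host part along each acyclic one (`card_treeSet_le`), then the parent of
EVERY part summed over ALL parts (`Finset.sum_prod_piFinset`). [folklore] -/
theorem card_forestSet_le (N : I → I → ℕ)
    (hN : ∀ i, i ≠ h → ∀ j q, (univ.filter fun p : Pos => ok i p ∧ touch i p j q).card ≤ N i j) :
    (forestSet ok touch h p₀).card ≤ ∏ i : {i // i ≠ h}, ∑ j, N i.1 j := by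
  -- the acyclic parent maps on the non-host parts
  let Ac : ({i // i ≠ h} → I) → Prop := fun f => ∃ rk : I → ℕ, ∀ i : {i // i ≠ h}, rk (f i) < rk i.1
  have hcover : forestSet ok touch h p₀ ⊆ (univ.filter Ac).biUnion (treeSet ok touch h p₀) := by
    intro c hc
    rw [mem_forestSet] at hc
    obtain ⟨hh, par, ⟨rk, hrk⟩, hpar⟩ := hc
    refine mem_biUnion.2 ⟨fun i => par i.1, mem_filter.2 ⟨mem_univ _, rk, fun i => hrk i.1 i.2⟩, ?_⟩
    simp only [treeSet, mem_filter, mem_univ, true_and]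
    exact ⟨hh, fun i => hpar i.1 i.2⟩
  have hf : ∀ f ∈ univ.filter Ac, (treeSet ok touch h p₀ f).card ≤ ∏ i : {i // i ≠ h}, N i.1 (f i) := by
    intro f hfA
    obtain ⟨rk, hrk⟩ := (mem_filter.1 hfA).2
    exact card_treeSet_le N hN f rk hrk
  calc (forestSet ok touch h p₀).card ≤ ((univ.filter Ac).biUnion (treeSet ok touch h p₀)).card := card_le_card hcover
    _ ≤ ∑ f ∈ univ.filter Ac, (treeSet ok touch h p₀ f).card := card_biUnion_le
    _ ≤ ∑ f ∈ univ.filter Ac, ∏ i : {i // i ≠ h}, N i.1 (f i) := sum_le_sum hf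
    _ ≤ ∑ f : {i // i ≠ h} → I, ∏ i : {i // i ≠ h}, N i.1 (f i) :=
        sum_le_sum_of_subset_of_nonneg (filter_subset _ _) fun _ _ _ => Nat.zero_le _
    _ = ∏ i : {i // i ≠ h}, ∑ j, N i.1 j := by
        rw [← Fintype.piFinset_univ, Finset.sum_prod_piFinset]

end Count

/-! ## §3 Invariance under relabelling the parts -/

section Perm

variable {I Pos : Type*} {ok : I → Pos → Prop} {touch : I → Pos → I → Pos → Prop} {h : I}

/-- one direction of the invariance: pull a forest back along a permutation of the parts that fixes the host and
along which `ok` and `touch` are invariant [folklore] -/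
theorem forestAdm_comp_perm_of (σ : Equiv.Perm I) (hσ : σ h = h) (hok : ∀ i p, ok (σ i) p ↔ ok i p)
    (ht : ∀ i p j q, touch (σ i) p (σ j) q ↔ touch i p j q) {c : I → Pos} (hc : ForestAdm ok touch h c) :
    ForestAdm ok touch h (c ∘ σ) := by
  obtain ⟨par, ⟨rk, hrk⟩, hpar⟩ := hc
  have hne : ∀ i, i ≠ h → σ i ≠ h := fun i hi heq => hi (σ.injective (heq.trans hσ.symm))
  refine ⟨fun i => σ.symm (par (σ i)), ⟨fun i => rk (σ i), fun i hi => ?_⟩, fun i hi => ?_⟩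
  · simpa using hrk (σ i) (hne i hi)
  · obtain ⟨h1, h2⟩ := hpar (σ i) (hne i hi)
    refine ⟨(hok i _).1 h1, ?_⟩
    have := (ht i (c (σ i)) (σ.symm (par (σ i))) (c (par (σ i)))).1 (by simpa using h2)
    simpa [Function.comp] using this

/-- **INVARIANCE OF FOREST ADMISSIBILITY** under a permutation of the parts fixing the host along which `ok` and
`touch` are invariant (parts read through their tagged shape only, the permutation preserving shapes). [folklore] -/
theorem forestAdm_comp_perm (σ : Equiv.Perm I) (hσ : σ h = h) (hok : ∀ i p, ok (σ i) p ↔ ok i p)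
    (ht : ∀ i p j q, touch (σ i) p (σ j) q ↔ touch i p j q) (c : I → Pos) :
    ForestAdm ok touch h (c ∘ σ) ↔ ForestAdm ok touch h c := by
  refine ⟨fun hc => ?_, forestAdm_comp_perm_of σ hσ hok ht⟩
  have hσ' : σ.symm h = h := by rw [Equiv.symm_apply_eq]; exact hσ.symm
  have hok' : ∀ i p, ok (σ.symm i) p ↔ ok i p := fun i p => by simpa using (hok (σ.symm i) p).symm
  have ht' : ∀ i p j q, touch (σ.symm i) p (σ.symm j) q ↔ touch i p j q := fun i p j q => by
    simpa using (ht (σ.symm i) p (σ.symm j) q).symm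
  have := forestAdm_comp_perm_of σ.symm hσ' hok' ht' hc
  simpa [Function.comp_def] using this

variable [Fintype I] [DecidableEq I] [Fintype Pos] [DecidableEq Pos]

/-- **THE FOREST HULL IS INVARIANT**: `c ∘ σ ∈ forestSet ↔ c ∈ forestSet` for such a permutation `σ`. [folklore] -/
theorem mem_forestSet_comp_perm (σ : Equiv.Perm I) (hσ : σ h = h) (hok : ∀ i p, ok (σ i) p ↔ ok i p)
    (ht : ∀ i p j q, touch (σ i) p (σ j) q ↔ touch i p j q) (p₀ : Pos) (c : I → Pos) :
    c ∘ σ ∈ forestSet ok touch h p₀ ↔ c ∈ forestSet ok touch h p₀ := by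
  rw [mem_forestSet, mem_forestSet, forestAdm_comp_perm σ hσ hok ht c, Function.comp_apply, hσ]

end Perm

/-! ## §4 The product form of the bound -/

section ProductForm

variable {I : Type*} [Fintype I] [DecidableEq I]

open scoped Classical

/-- **PRODUCT FORM**: with a slot bound that factors as `N i j ≤ A i * B j` (partner side `A i` = one-block touch
count × age fibre × internal placements; host side `B j` = the cardinality of the touched part's zone; reals) the
forest bound is `(Σ_j B j)^{#parts − 1} · ∏_{i ≠ h} A i`. [folklore] -/
theorem prod_sum_mul_eq_real (h : I) (A B : I → ℝ) :
    ∏ i : {i // i ≠ h}, ∑ j, A i.1 * B j = (∑ j, B j) ^ (Fintype.card I - 1) * ∏ i : {i // i ≠ h}, A i.1 := by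
  have h1 : ∀ i : {i // i ≠ h}, ∑ j, A i.1 * B j = A i.1 * ∑ j, B j := fun i => by rw [mul_sum]
  have hcard : (univ : Finset {i // i ≠ h}).card = Fintype.card I - 1 := by
    rw [card_univ]
    change Fintype.card {i // ¬ i = h} = _
    rw [Fintype.card_subtype_compl, Fintype.card_subtype_eq]
  rw [prod_congr rfl fun i _ => h1 i, prod_mul_distrib, prod_const, mul_comm, hcard]

/-- **THE FOREST COUNT, REAL-VALUED PRODUCT FORM**: if the slot bound is dominated by reals `A i * B j` then
`#forestSet ≤ (Σ_j B j)^{#parts−1} · ∏_{i ≠ h} A i`. [folklore] -/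
theorem card_forestSet_le_pow_mul {Pos : Type*} [Fintype Pos] [DecidableEq Pos] (ok : I → Pos → Prop)
    (touch : I → Pos → I → Pos → Prop) (h : I) (p₀ : Pos) (N : I → I → ℕ)
    (hN : ∀ i, i ≠ h → ∀ j q, (Finset.univ.filter fun p : Pos => ok i p ∧ touch i p j q).card ≤ N i j)
    (A B : I → ℝ) (hAB : ∀ i, i ≠ h → ∀ j, (N i j : ℝ) ≤ A i * B j) :
    ((forestSet ok touch h p₀).card : ℝ) ≤ (∑ j, B j) ^ (Fintype.card I - 1) * ∏ i : {i // i ≠ h}, A i.1 := by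
  have h1 : ((forestSet ok touch h p₀).card : ℝ) ≤ ∏ i : {i // i ≠ h}, ∑ j, (N i.1 j : ℝ) := by
    have := card_forestSet_le (p₀ := p₀) (ok := ok) (touch := touch) N hN
    exact_mod_cast this
  rw [← prod_sum_mul_eq_real h A B]
  refine h1.trans (prod_le_prod (fun i _ => sum_nonneg fun j _ => Nat.cast_nonneg _) fun i _ => ?_)
  exact sum_le_sum fun j _ => hAB i.1 i.2 j

end ProductForm

/-! ## §5 Sanity -/

namespace Sanity

/-- a path `… → 2 → 1 → 0` (part `i+1` touching only part `i`) is forest-admissible through the contact order `id`,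
although no part beyond `1` touches the host -/
example : ForestAdm (I := ℕ) (Pos := Unit) (fun _ _ => True) (fun i _ j _ => j + 1 = i) 0 (fun _ => ()) :=
  forestAdm_of_chain _ _ 0 _ id fun i hi => ⟨trivial, i - 1, by simp only [id]; omega, by omega⟩

end Sanity

end

end Summit.QuantumFields.BalabanUV.T4Continuum.HistorySiblingSymmetry
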